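/-
Copyright (c) 2026 the pub-hodgecm-mathlib formalisation cell (harness21).  Prover seat hodgecm-mathlib-K2Liu-p27 (g2), Track B «K2-LIT»,
#184♮ = hLiu418 = `stmt-HodgeConjecture-24832`; LEAD F0P6-plan (g14) BATCH #92 (3) 22:36:58Z «FACE-A's ARCH INPUT
`Theorems/K2LiuArchDefiniteScalarVanishing.lean`» (K2Liu-p10 (g6) 22:32:45Z (3); R90-C10-p03 (g0) CENSUS `hA` §4 (L-a)(L-b) «TWIST»).
THEOREMS ONLY (no `def`, no `instance`, no notation, no named-fact hypothesis, no `sorry`); lane `--supports stmt-HodgeConjecture-24832 --as helper`.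
-/
import Summits.HodgeConjecture.HodgeConjecture.Theorems.K2LiuArchIntertwiningContinuedHalf   -- ★ (A∞-½) faces on PURE scalar types
import Summits.HodgeConjecture.HodgeConjecture.Theorems.K2LiuArchGaussianKTypeFrame          -- ★ S2-F: the Gaussian anchor `c·det(g)^{m₁}·f⁰_{s,m₁−m₂}`
import HarnessLib

/-!
# Crux `HLiu418`, A∞ organ ∕ FACE-A arch input: the continued normalised operator KILLS THE DEFINITE GAUSSIAN LINE at `s = ½`
# — both signs `(3,0)` ∕ `(0,3)`, with the central det-twist of the anchor of record

Cell `hodgecm-mathlib`, crux item hLiu418 = `stmt-HodgeConjecture-24832` (helper lane `--supports`, count-neutral; closes no socket).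

WHAT FACE-A's LOCAL ROAD NEEDS AT A DEFINITE PLACE `σ` (R90-C10-p03 (g0) census §4; K2Liu-p10 (g6) 22:32:45Z (3)).  For `V′_σ` DEFINITE of
signature `(p′, q′) ∈ {(3,0), (0,3)}` the arch Siegel–Weil section of the Gaussian of `V′_σ ⊗ W` is the ANCHOR OF RECORD of ★ S2-F
(`K2LiuArchGaussianKType[Frame]`): a Siegel section of `I_w(s, χ_{−(m₁+m₂)})` with the scalar `K_w ≅ U(2) × U(2)`-character
`κ(a,b) ↦ det(a)^{m₁}·det(b)^{m₂}`, hence EQUAL to `c · det(g)^{m₁} · f⁰_{s, m₁−m₂}(g)` on `U(J)` (★ `eq_mul_det_zpow_mul_archScalarSection_of_kappaType`),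
with scalar index `k_σ = m₁ − m₂ = p′ − q′ = ±3` — odd, `|k_σ| = 3 ≠ 1`.  The ★ arch capital already gives the kernel at `½` for EVERY odd scalar
type `|k| ≠ 1`, sign-symmetrically (★ `archNormalisedScalarCont_half_eq_zero`, ★ `K2LiuArchIntertwiningContinuedHalf.half_eq_zero`), but for the
PURE type (`m₁ = 0`) only.  This file supplies the one missing letter — the CENTRAL DET-TWIST under the intertwining integral — and re-issues the
(A∞-½) faces for the twisted anchor, then BY VALUE for the definite signatures:
* §1 signature bookkeeping (reading lemmas): `p′ + q′ = 3`, `p′ = 0 ∨ q′ = 0` ⇒ `p′ − q′ = ±3`, odd, `natAbs = 3`; `n_{p′−q′}(½) = 0`, `n_{±3}(½) = 0`.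
* §2 TWIST: `det (J · transl(hermOfReal r) · g) = det g` (`det J = 1`, Mathlib `SymplecticGroup.det_eq_one`), hence
  `archIntertwining (det^m · f) g = det(g)^m · archIntertwining f g` FOR FREE (no integrability), the same for `archIntertwiningNormalized`, and the
  twisted (L1′) `M*_w(s) (c·det^m·f⁰_{s,k}) (h) = c · det(h)^m · n_k(s) · f⁰_{−s,k}(h)` (`re s > ½`, `h ∈ U(2,2)`).
* §3 the twisted continuation faces (identity theorem = ★ `eq_contClosedForm_of_re_pos_archScalarSection` with the constant `c·det(h)^m`):
  `eq_contClosedForm_of_re_pos_detTwist`, **`half_eq_zero_detTwist`** (odd `|k| ≠ 1` ⇒ `Fn(½) = 0`), `half_eq_detTwist_of_natAbs_eq_one` (`k = ±1`).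
* §4 HYPOTHESIS-FIRST in the `Stab(i1)`-letters of ★ S2-F part 1 (`hP`, `hK` of ★ `eq_mul_det_zpow_mul_archScalarSection` VERBATIM: a flat family
  `F s` with the parabolic law of `I_w(s, χ_{−(m₁+m₂)})`, the scalar type `det(A_u+iB_u)^{m₁}·det(A_u−iB_u)^{m₂}` and `F s 1 = c` on `½ < re s`):
  `archIntertwining_eq_of_stabType` (the integral only sees `U(J)`), **`half_eq_zero_of_stabType`** (odd `m₁ − m₂`, `|m₁ − m₂| ≠ 1`),
  **`half_eq_zero_of_stabType_definite`** (`m₁ − m₂ = ±3`), the (A∞-R) twin `half_eq_of_stabType_of_natAbs_eq_one` (indefinite anchors `±1`);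
* §5 the same in the κ-CHART letters of ★ S2-F part 2 (`hκ` of ★ `eq_mul_det_zpow_mul_archScalarSection_of_kappaType` VERBATIM, via ★
  `stabType_of_kappaType_UJ`): **`half_eq_zero_of_kappaType[_definite∕_signature]`** (`p′ + q′ = 3`, `p′ = 0 ∨ q′ = 0`, `m₁ − m₂ = p′ − q′`),
  the function-level `half_apply_eq_zero_of_kappaType_definite`, and `half_eq_of_kappaType_of_natAbs_eq_one`.
Not covered here (census (L-c), organ-sized): the passage from the Gaussian LINE to the whole definite Fock tower `R_σ(V′_σ)` (non-scalar `K_σ`-types).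
References: [Shimura1982, (1.31)]; [Shimura1997, §16.4]; [KudlaRallis1994 (citation only)]; [KudlaSweet1997, §1 (citation only)] — derived here from ★ capital + Mathlib.
HONEST LABEL: HC_CM is proved only modulo the 7 printed citations (2 remaining named inputs: hLiu418 = stmt-HodgeConjecture-24832,
h413 = stmt-HodgeConjecture-24833) until rung 0 closes; count-neutral helper, closes no socket.
-/

set_option autoImplicit false
set_option linter.dupNamespace false

noncomputable section

open Complex Set Matrix MeasureTheory Filter
open scoped ComplexConjugate Topology

namespace Summit.HodgeConjecture.HodgeConjecture.Cruxes.HLiu418.K2LiuArchDefiniteScalarVanishing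

open Literature.NumberTheory.ModularForms.SiegelUpperHalfSpace (denom moeb)
open Summit.HodgeConjecture.HodgeConjecture.Cruxes.HLiu418.K2LiuHermitianTubeCocycle
open Summit.HodgeConjecture.HodgeConjecture.Cruxes.HLiu418.K2LiuArchInducedTubeDefs
open Summit.HodgeConjecture.HodgeConjecture.Cruxes.HLiu418.K2LiuArchNormalisingScalar
open Summit.HodgeConjecture.HodgeConjecture.Cruxes.HLiu418.K2LiuArchNormalisedScalarCont
open Summit.HodgeConjecture.HodgeConjecture.Cruxes.HLiu418.K2LiuArchIntertwiningRightEquivariance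
open Summit.HodgeConjecture.HodgeConjecture.Cruxes.HLiu418.K2LiuArchIntertwiningContinuedHalf
open Summit.HodgeConjecture.HodgeConjecture.Cruxes.HLiu418.K2LiuArchGaussianKType
open Summit.HodgeConjecture.HodgeConjecture.Cruxes.HLiu418.K2LiuArchGaussianKTypeFrame

/-! ## §1  Signature bookkeeping: the definite signatures have scalar index `±3` (reading lemmas) -/

/-- A definite signature in dimension `3` has `p′ − q′ = ±3`. [folklore] -/
theorem sub_eq_three_or_eq_neg_three_of_definite {p q : ℕ} (hpq : p + q = 3) (hdef : p = 0 ∨ q = 0) :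
    (p : ℤ) - q = 3 ∨ (p : ℤ) - q = -3 := by
  omega

/-- `p′ − q′` is odd when `p′ + q′ = 3`. [folklore] -/
theorem odd_sub_of_add_eq_three {p q : ℕ} (hpq : p + q = 3) : Odd ((p : ℤ) - q) :=
  ⟨(p : ℤ) - 2, by omega⟩

/-- A definite signature in dimension `3` has `|p′ − q′| = 3 ≠ 1` (the definite Gaussian is OFF the pinned line types `±1`). [folklore] -/
theorem natAbs_sub_ne_one_of_definite {p q : ℕ} (hpq : p + q = 3) (hdef : p = 0 ∨ q = 0) : ((p : ℤ) - q).natAbs ≠ 1 := by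
  omega

/-- `m₁ − m₂ = ±3 ⇒` odd. [folklore] -/
theorem odd_of_eq_three_or_eq_neg_three {k : ℤ} (h : k = 3 ∨ k = -3) : Odd k := by
  rcases h with rfl | rfl <;> decide

/-- `m₁ − m₂ = ±3 ⇒ |m₁ − m₂| ≠ 1`. [folklore] -/
theorem natAbs_ne_one_of_eq_three_or_eq_neg_three {k : ℤ} (h : k = 3 ∨ k = -3) : k.natAbs ≠ 1 := by
  rcases h with rfl | rfl <;> decide

/-- **READING LEMMA, BY VALUE `k = 3`** (signature `(3,0)`): `n_3(½) = 0` (★ (L3b)). [Shimura1982, (1.31)] -/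
theorem archNormalisedScalarCont_three_half_eq_zero : archNormalisedScalarCont 3 (1 / 2) = 0 :=
  archNormalisedScalarCont_half_eq_zero (by decide) (by decide)

/-- **READING LEMMA, BY VALUE `k = −3`** (signature `(0,3)`): `n_{−3}(½) = 0` (★ (L3b), sign-symmetric). [Shimura1982, (1.31)] -/
theorem archNormalisedScalarCont_neg_three_half_eq_zero : archNormalisedScalarCont (-3) (1 / 2) = 0 :=
  archNormalisedScalarCont_half_eq_zero (by decide) (by decide)

/-- **READING LEMMA IN THE SIGNATURE LETTERS**: for a DEFINITE signature `(p′, q′)` in dimension `3` (either sign) the continued normalised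
scalar of the scalar type `k_σ = p′ − q′` vanishes at `½`: `n_{p′−q′}(½) = 0`. [Shimura1982, (1.31)] -/
theorem archNormalisedScalarCont_half_eq_zero_of_definite {p q : ℕ} (hpq : p + q = 3) (hdef : p = 0 ∨ q = 0) :
    archNormalisedScalarCont ((p : ℤ) - q) (1 / 2) = 0 :=
  archNormalisedScalarCont_half_eq_zero (odd_sub_of_add_eq_three hpq) (natAbs_sub_ne_one_of_definite hpq hdef)

/-- The same in the κ-character letters: `m₁ − m₂ = ±3 ⇒ n_{m₁−m₂}(½) = 0`. [Shimura1982, (1.31)] -/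
theorem archNormalisedScalarCont_half_eq_zero_of_eq_three_or {k : ℤ} (h : k = 3 ∨ k = -3) : archNormalisedScalarCont k (1 / 2) = 0 :=
  archNormalisedScalarCont_half_eq_zero (odd_of_eq_three_or_eq_neg_three h) (natAbs_ne_one_of_eq_three_or_eq_neg_three h)

/-! ## §2  The central det-twist under the intertwining integral -/

section Generic

variable {l : Type*} [Fintype l] [DecidableEq l]

/-- **`det (J · transl(hermOfReal r) · g) = det g`**: `det J = 1` (Mathlib: `J` is symplectic) and `det (1 X; 0 1) = 1`. [folklore] -/
theorem det_J_mul_transl_mul (r : l → l → ℝ) (g : Matrix (l ⊕ l) (l ⊕ l) ℂ) :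
    (Matrix.J l ℂ * fromBlocks 1 (hermOfReal r) 0 1 * g).det = g.det := by
  rw [Matrix.det_mul, Matrix.det_mul, Matrix.det_fromBlocks_zero₂₁, Matrix.det_one, mul_one, mul_one,
    SymplecticGroup.det_eq_one (SymplecticGroup.J_mem l ℂ), one_mul]

/-- **THE DET-TWIST COMES OUT OF `M_w` FOR FREE**: `archIntertwining (det^m · f) g = det(g)^m · archIntertwining f g` (the integrand's group
elements `J·n·g` all have determinant `det g`; no integrability needed). [Shimura1997, §16.4] -/
theorem archIntertwining_det_zpow_mul (m : ℤ) (f : Matrix (l ⊕ l) (l ⊕ l) ℂ → ℂ) (g : Matrix (l ⊕ l) (l ⊕ l) ℂ) :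
    archIntertwining (fun x => x.det ^ m * f x) g = g.det ^ m * archIntertwining f g := by
  rw [archIntertwining_apply, archIntertwining_apply, ← integral_const_mul]
  refine integral_congr_ae (Eventually.of_forall fun r => ?_)
  dsimp only
  rw [det_J_mul_transl_mul]

/-- The same with an extra scalar: `archIntertwining (c · det^m · f) g = c · det(g)^m · archIntertwining f g`. [Shimura1997, §16.4] -/
theorem archIntertwining_const_mul_det_zpow_mul (c : ℂ) (m : ℤ) (f : Matrix (l ⊕ l) (l ⊕ l) ℂ → ℂ) (g : Matrix (l ⊕ l) (l ⊕ l) ℂ) :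
    archIntertwining (fun x => c * x.det ^ m * f x) g = c * g.det ^ m * archIntertwining f g := by
  have h1 : (fun x : Matrix (l ⊕ l) (l ⊕ l) ℂ => c * x.det ^ m * f x) = fun x => c * (x.det ^ m * f x) :=
    funext fun x => mul_assoc _ _ _
  rw [h1, archIntertwining_const_mul, archIntertwining_det_zpow_mul, mul_assoc]

end Generic

/-- **THE DET-TWIST COMES OUT OF THE NORMALISED OPERATOR**: `M*_w(s) (det^m · f) (g) = det(g)^m · M*_w(s) f (g)`. [KudlaRallis1994 (citation only)] -/
theorem archIntertwiningNormalized_det_zpow_mul (m : ℤ) (s : ℂ) (f : Matrix (Fin 2 ⊕ Fin 2) (Fin 2 ⊕ Fin 2) ℂ → ℂ)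
    (g : Matrix (Fin 2 ⊕ Fin 2) (Fin 2 ⊕ Fin 2) ℂ) :
    archIntertwiningNormalized s (fun x => x.det ^ m * f x) g = g.det ^ m * archIntertwiningNormalized s f g := by
  rw [archIntertwiningNormalized_apply, archIntertwiningNormalized_apply, archIntertwining_det_zpow_mul]
  ring

/-- … with an extra scalar: `M*_w(s) (c · det^m · f) (g) = c · det(g)^m · M*_w(s) f (g)`. [KudlaRallis1994 (citation only)] -/
theorem archIntertwiningNormalized_const_mul_det_zpow_mul (c : ℂ) (m : ℤ) (s : ℂ) (f : Matrix (Fin 2 ⊕ Fin 2) (Fin 2 ⊕ Fin 2) ℂ → ℂ)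
    (g : Matrix (Fin 2 ⊕ Fin 2) (Fin 2 ⊕ Fin 2) ℂ) :
    archIntertwiningNormalized s (fun x => c * x.det ^ m * f x) g = c * g.det ^ m * archIntertwiningNormalized s f g := by
  rw [archIntertwiningNormalized_apply, archIntertwiningNormalized_apply, archIntertwining_const_mul_det_zpow_mul]
  ring

/-- The twisted scalar-type family is a scalar multiple of the pure one AT FIXED `h`:
`M*_w(s) (c · det^m · f⁰_{s,k}) (h) = M*_w(s) ((c · det(h)^m) · f⁰_{s,k}) (h)`. [folklore] -/
theorem archIntertwiningNormalized_detTwist_eq_const (c : ℂ) (m k : ℤ) (s : ℂ) (h : Matrix (Fin 2 ⊕ Fin 2) (Fin 2 ⊕ Fin 2) ℂ) :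
    archIntertwiningNormalized s (fun g => c * g.det ^ m * archScalarSection k s g) h =
      archIntertwiningNormalized s (fun g => c * h.det ^ m * archScalarSection k s g) h := by
  rw [archIntertwiningNormalized_const_mul_det_zpow_mul, archIntertwiningNormalized_apply, archIntertwiningNormalized_apply,
    archIntertwining_const_mul]
  ring

/-- **TWISTED (L1′): `M*_w(s) (c · det^m · f⁰_{s,k}) (h) = c · det(h)^m · n_k(s) · f⁰_{−s,k}(h)`** on `U(2,2)`, `re s > ½`, every `k m : ℤ`
(★ (L1′) `archIntertwiningNormalized_archScalarSection_eq_cont` + §2). [Shimura1982, (1.31); Shimura1997, §16.4] -/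
theorem archIntertwiningNormalized_detTwist_archScalarSection_eq_cont (c : ℂ) (m k : ℤ) {s : ℂ} (hs : 1 / 2 < s.re)
    {h : Matrix (Fin 2 ⊕ Fin 2) (Fin 2 ⊕ Fin 2) ℂ} (hh : hᴴ * Matrix.J (Fin 2) ℂ * h = Matrix.J (Fin 2) ℂ) :
    archIntertwiningNormalized s (fun g => c * g.det ^ m * archScalarSection k s g) h =
      c * h.det ^ m * archNormalisedScalarCont k s * archScalarSection k (-s) h := by
  rw [archIntertwiningNormalized_const_mul_det_zpow_mul, archIntertwiningNormalized_archScalarSection_eq_cont k hs hh]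
  ring

/-! ## §3  The twisted continuation faces at `s = ½` -/

/-- **TWISTED CLOSED FORM ON `{0 < re s}`** (odd `k`): every holomorphic `Fn` on `{0 < re s}` agreeing with
`s ↦ M*_w(s) (c · det^m · f⁰_{s,k}) (h)` on `½ < re s` equals `c · det(h)^m · n_k(s) · f⁰_{−s,k}(h)` there (★ identity-theorem transport
`eq_contClosedForm_of_re_pos_archScalarSection` with the constant `c · det(h)^m`). [Shimura1982, (1.31)] -/
theorem eq_contClosedForm_of_re_pos_detTwist {k : ℤ} (hk : Odd k) (c : ℂ) (m : ℤ)
    {h : Matrix (Fin 2 ⊕ Fin 2) (Fin 2 ⊕ Fin 2) ℂ} (hh : hᴴ * Matrix.J (Fin 2) ℂ * h = Matrix.J (Fin 2) ℂ)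
    {Fn : ℂ → ℂ} (hFn : DifferentiableOn ℂ Fn {s : ℂ | 0 < s.re})
    (hagree : ∀ s : ℂ, 1 / 2 < s.re → Fn s = archIntertwiningNormalized s (fun g => c * g.det ^ m * archScalarSection k s g) h)
    {s : ℂ} (hs : 0 < s.re) :
    Fn s = c * h.det ^ m * archNormalisedScalarCont k s * archScalarSection k (-s) h :=
  eq_contClosedForm_of_re_pos_archScalarSection hk (c * h.det ^ m) hh hFn
    (fun s hs' => by rw [hagree s hs', archIntertwiningNormalized_detTwist_eq_const]) hs

/-- **TWISTED (A∞-½) KERNEL FACE**: odd `|k| ≠ 1` ⇒ every holomorphic continuation to `{0 < re s}` of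
`s ↦ M*_w(s) (c · det^m · f⁰_{s,k}) (h)` VANISHES at `s = ½` — the continued normalised operator kills the det-twisted scalar-type line.
[Shimura1982, (1.31)] -/
theorem half_eq_zero_detTwist {k : ℤ} (hk : Odd k) (h1 : k.natAbs ≠ 1) (c : ℂ) (m : ℤ)
    {h : Matrix (Fin 2 ⊕ Fin 2) (Fin 2 ⊕ Fin 2) ℂ} (hh : hᴴ * Matrix.J (Fin 2) ℂ * h = Matrix.J (Fin 2) ℂ)
    {Fn : ℂ → ℂ} (hFn : DifferentiableOn ℂ Fn {s : ℂ | 0 < s.re})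
    (hagree : ∀ s : ℂ, 1 / 2 < s.re → Fn s = archIntertwiningNormalized s (fun g => c * g.det ^ m * archScalarSection k s g) h) :
    Fn (1 / 2) = 0 := by
  rw [eq_contClosedForm_of_re_pos_detTwist hk c m hh hFn hagree one_half_re_pos, archNormalisedScalarCont_half_eq_zero hk h1,
    mul_zero, zero_mul]

/-- **TWISTED (A∞-R) FACE ON THE PINNED TYPES `k = ±1`** (the INDEFINITE Gaussian anchors): the continuation takes the value
`c · det(h)^m · f⁰_{−½,k}(h)` at `s = ½`. [KudlaRallis1994 (citation only); Shimura1982, (1.31)] -/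
theorem half_eq_detTwist_of_natAbs_eq_one {k : ℤ} (h1 : k.natAbs = 1) (c : ℂ) (m : ℤ)
    {h : Matrix (Fin 2 ⊕ Fin 2) (Fin 2 ⊕ Fin 2) ℂ} (hh : hᴴ * Matrix.J (Fin 2) ℂ * h = Matrix.J (Fin 2) ℂ)
    {Fn : ℂ → ℂ} (hFn : DifferentiableOn ℂ Fn {s : ℂ | 0 < s.re})
    (hagree : ∀ s : ℂ, 1 / 2 < s.re → Fn s = archIntertwiningNormalized s (fun g => c * g.det ^ m * archScalarSection k s g) h) :
    Fn (1 / 2) = c * h.det ^ m * archScalarSection k (-(1 / 2)) h := by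
  rw [eq_contClosedForm_of_re_pos_detTwist (odd_of_natAbs_eq_one h1) c m hh hFn hagree one_half_re_pos,
    archNormalisedScalarCont_half_of_natAbs_eq_one h1, mul_one]


/-! ## §4  Hypothesis-first in the `Stab(i1)`-letters of ★ S2-F part 1 (`eq_mul_det_zpow_mul_archScalarSection`'s `hP`, `hK` VERBATIM) -/

/-- **THE INTERTWINING INTEGRAL ONLY SEES `U(J)`**: if `f` has the parabolic law of `I_w(s, χ_{−(m₁+m₂)})` and the scalar `K_w`-type
`f(g u) = det(A_u+iB_u)^{m₁}·det(A_u−iB_u)^{m₂}·f(g)` on `Stab(i1)` (★ part 1 letters), then for `h ∈ U(J)`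
`M_w f (h) = M_w (f(1) · det^{m₁} · f⁰_{s,m₁−m₂}) (h)` (★ `eq_mul_det_zpow_mul_archScalarSection` under the integral: the points `J·n·h` lie in `U(J)`).
[Shimura1997, §16.4] -/
theorem archIntertwining_eq_of_stabType (m₁ m₂ : ℤ) (s : ℂ) {f : Matrix (Fin 2 ⊕ Fin 2) (Fin 2 ⊕ Fin 2) ℂ → ℂ}
    (hP : IsArchSiegelSection (fun z : ℂ => (conj z / ((‖z‖ : ℝ) : ℂ)) ^ (-(m₁ + m₂))) s f)
    (hK : ∀ g u : Matrix (Fin 2 ⊕ Fin 2) (Fin 2 ⊕ Fin 2) ℂ, gᴴ * Matrix.J (Fin 2) ℂ * g = Matrix.J (Fin 2) ℂ →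
      uᴴ * Matrix.J (Fin 2) ℂ * u = Matrix.J (Fin 2) ℂ → moeb u (I • (1 : Matrix (Fin 2) (Fin 2) ℂ)) = I • 1 →
        f (g * u) = (u.toBlocks₁₁ + I • u.toBlocks₁₂).det ^ m₁ * (u.toBlocks₁₁ - I • u.toBlocks₁₂).det ^ m₂ * f g)
    {h : Matrix (Fin 2 ⊕ Fin 2) (Fin 2 ⊕ Fin 2) ℂ} (hh : hᴴ * Matrix.J (Fin 2) ℂ * h = Matrix.J (Fin 2) ℂ) :
    archIntertwining f h = archIntertwining (fun g => f 1 * g.det ^ m₁ * archScalarSection (m₁ - m₂) s g) h := by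
  rw [archIntertwining_apply, archIntertwining_apply]
  refine integral_congr_ae (Eventually.of_forall fun r => ?_)
  dsimp only
  rw [eq_mul_det_zpow_mul_archScalarSection m₁ m₂ s hP hK (mul_mem_UJ (J_mul_transl_hermOfReal_mem r) hh)]

/-- **(L1′) FOR THE TWISTED SCALAR-TYPE ANCHOR**: `M*_w(s) f (h) = f(1) · det(h)^{m₁} · n_{m₁−m₂}(s) · f⁰_{−s,m₁−m₂}(h)` on `U(2,2)`, `re s > ½`.
[Shimura1982, (1.31); Shimura1997, §16.4] -/
theorem archIntertwiningNormalized_eq_contClosedForm_of_stabType (m₁ m₂ : ℤ) {s : ℂ} (hs : 1 / 2 < s.re)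
    {f : Matrix (Fin 2 ⊕ Fin 2) (Fin 2 ⊕ Fin 2) ℂ → ℂ}
    (hP : IsArchSiegelSection (fun z : ℂ => (conj z / ((‖z‖ : ℝ) : ℂ)) ^ (-(m₁ + m₂))) s f)
    (hK : ∀ g u : Matrix (Fin 2 ⊕ Fin 2) (Fin 2 ⊕ Fin 2) ℂ, gᴴ * Matrix.J (Fin 2) ℂ * g = Matrix.J (Fin 2) ℂ →
      uᴴ * Matrix.J (Fin 2) ℂ * u = Matrix.J (Fin 2) ℂ → moeb u (I • (1 : Matrix (Fin 2) (Fin 2) ℂ)) = I • 1 →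
        f (g * u) = (u.toBlocks₁₁ + I • u.toBlocks₁₂).det ^ m₁ * (u.toBlocks₁₁ - I • u.toBlocks₁₂).det ^ m₂ * f g)
    {h : Matrix (Fin 2 ⊕ Fin 2) (Fin 2 ⊕ Fin 2) ℂ} (hh : hᴴ * Matrix.J (Fin 2) ℂ * h = Matrix.J (Fin 2) ℂ) :
    archIntertwiningNormalized s f h = f 1 * h.det ^ m₁ * archNormalisedScalarCont (m₁ - m₂) s * archScalarSection (m₁ - m₂) (-s) h := by
  rw [archIntertwiningNormalized_apply, archIntertwining_eq_of_stabType m₁ m₂ s hP hK hh, ← archIntertwiningNormalized_apply,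
    archIntertwiningNormalized_detTwist_archScalarSection_eq_cont _ _ _ hs hh]

/-- **THE CONTINUATION OF A FLAT TWISTED SCALAR-TYPE FAMILY IS THE TWISTED CLOSED FORM ON `{0 < re s}`** (odd `m₁ − m₂`): for `F s` with the
parabolic law of `I_w(s, χ_{−(m₁+m₂)})`, the scalar type `det(A_u+iB_u)^{m₁}·det(A_u−iB_u)^{m₂}` and `F s 1 = c` on `½ < re s`, every holomorphic
`Fn` on `{0 < re s}` agreeing with `M*_w(s) (F s) (h)` there equals `c · det(h)^{m₁} · n_{m₁−m₂}(s) · f⁰_{−s,m₁−m₂}(h)`. [Shimura1982, (1.31)] -/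
theorem eq_contClosedForm_of_re_pos_of_stabType (m₁ m₂ : ℤ) (hodd : Odd (m₁ - m₂)) {c : ℂ}
    {h : Matrix (Fin 2 ⊕ Fin 2) (Fin 2 ⊕ Fin 2) ℂ} (hh : hᴴ * Matrix.J (Fin 2) ℂ * h = Matrix.J (Fin 2) ℂ)
    {F : ℂ → Matrix (Fin 2 ⊕ Fin 2) (Fin 2 ⊕ Fin 2) ℂ → ℂ}
    (hP : ∀ s : ℂ, 1 / 2 < s.re → IsArchSiegelSection (fun z : ℂ => (conj z / ((‖z‖ : ℝ) : ℂ)) ^ (-(m₁ + m₂))) s (F s))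
    (hK : ∀ s : ℂ, 1 / 2 < s.re → ∀ g u : Matrix (Fin 2 ⊕ Fin 2) (Fin 2 ⊕ Fin 2) ℂ,
      gᴴ * Matrix.J (Fin 2) ℂ * g = Matrix.J (Fin 2) ℂ → uᴴ * Matrix.J (Fin 2) ℂ * u = Matrix.J (Fin 2) ℂ →
        moeb u (I • (1 : Matrix (Fin 2) (Fin 2) ℂ)) = I • 1 →
          F s (g * u) = (u.toBlocks₁₁ + I • u.toBlocks₁₂).det ^ m₁ * (u.toBlocks₁₁ - I • u.toBlocks₁₂).det ^ m₂ * F s g)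
    (hF1 : ∀ s : ℂ, 1 / 2 < s.re → F s 1 = c)
    {Fn : ℂ → ℂ} (hFn : DifferentiableOn ℂ Fn {s : ℂ | 0 < s.re})
    (hagree : ∀ s : ℂ, 1 / 2 < s.re → Fn s = archIntertwiningNormalized s (F s) h)
    {s : ℂ} (hs : 0 < s.re) :
    Fn s = c * h.det ^ m₁ * archNormalisedScalarCont (m₁ - m₂) s * archScalarSection (m₁ - m₂) (-s) h :=
  eq_contClosedForm_of_re_pos_detTwist hodd c m₁ hh hFn
    (fun s hs' => by
      rw [hagree s hs', archIntertwiningNormalized_apply, archIntertwining_eq_of_stabType m₁ m₂ s (hP s hs') (hK s hs') hh,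
        hF1 s hs', ← archIntertwiningNormalized_apply]) hs

/-- **(A∞-½) KERNEL FACE FOR A FLAT TWISTED SCALAR-TYPE FAMILY** (odd `m₁ − m₂`, `|m₁ − m₂| ≠ 1`): every holomorphic continuation to
`{0 < re s}` of `s ↦ M*_w(s) (F s) (h)` vanishes at `s = ½`. [Shimura1982, (1.31)] -/
theorem half_eq_zero_of_stabType (m₁ m₂ : ℤ) (hodd : Odd (m₁ - m₂)) (h1 : (m₁ - m₂).natAbs ≠ 1) {c : ℂ}
    {h : Matrix (Fin 2 ⊕ Fin 2) (Fin 2 ⊕ Fin 2) ℂ} (hh : hᴴ * Matrix.J (Fin 2) ℂ * h = Matrix.J (Fin 2) ℂ)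
    {F : ℂ → Matrix (Fin 2 ⊕ Fin 2) (Fin 2 ⊕ Fin 2) ℂ → ℂ}
    (hP : ∀ s : ℂ, 1 / 2 < s.re → IsArchSiegelSection (fun z : ℂ => (conj z / ((‖z‖ : ℝ) : ℂ)) ^ (-(m₁ + m₂))) s (F s))
    (hK : ∀ s : ℂ, 1 / 2 < s.re → ∀ g u : Matrix (Fin 2 ⊕ Fin 2) (Fin 2 ⊕ Fin 2) ℂ,
      gᴴ * Matrix.J (Fin 2) ℂ * g = Matrix.J (Fin 2) ℂ → uᴴ * Matrix.J (Fin 2) ℂ * u = Matrix.J (Fin 2) ℂ →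
        moeb u (I • (1 : Matrix (Fin 2) (Fin 2) ℂ)) = I • 1 →
          F s (g * u) = (u.toBlocks₁₁ + I • u.toBlocks₁₂).det ^ m₁ * (u.toBlocks₁₁ - I • u.toBlocks₁₂).det ^ m₂ * F s g)
    (hF1 : ∀ s : ℂ, 1 / 2 < s.re → F s 1 = c)
    {Fn : ℂ → ℂ} (hFn : DifferentiableOn ℂ Fn {s : ℂ | 0 < s.re})
    (hagree : ∀ s : ℂ, 1 / 2 < s.re → Fn s = archIntertwiningNormalized s (F s) h) :
    Fn (1 / 2) = 0 := by
  rw [eq_contClosedForm_of_re_pos_of_stabType m₁ m₂ hodd hh hP hK hF1 hFn hagree one_half_re_pos,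
    archNormalisedScalarCont_half_eq_zero hodd h1, mul_zero, zero_mul]

/-- **THE DEFINITE GAUSSIAN LINE IS KILLED AT `½`, BOTH SIGNS** (`Stab`-letters, `m₁ − m₂ = ±3`): for the flat family through the arch SW section
of the Gaussian of a DEFINITE `V′_σ` (signature `(3,0)`: `m₁ − m₂ = 3`; `(0,3)`: `m₁ − m₂ = −3`; ★ S2-F anchor of record) every holomorphic
continuation to `{0 < re s}` of `s ↦ M*_w(s) (F s) (h)` vanishes at `s = ½` — FACE-A's arch input on the Gaussian line.
[Shimura1982, (1.31)] [KudlaSweet1997, §1 (citation only)] -/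
theorem half_eq_zero_of_stabType_definite (m₁ m₂ : ℤ) (hdef : m₁ - m₂ = 3 ∨ m₁ - m₂ = -3) {c : ℂ}
    {h : Matrix (Fin 2 ⊕ Fin 2) (Fin 2 ⊕ Fin 2) ℂ} (hh : hᴴ * Matrix.J (Fin 2) ℂ * h = Matrix.J (Fin 2) ℂ)
    {F : ℂ → Matrix (Fin 2 ⊕ Fin 2) (Fin 2 ⊕ Fin 2) ℂ → ℂ}
    (hP : ∀ s : ℂ, 1 / 2 < s.re → IsArchSiegelSection (fun z : ℂ => (conj z / ((‖z‖ : ℝ) : ℂ)) ^ (-(m₁ + m₂))) s (F s))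
    (hK : ∀ s : ℂ, 1 / 2 < s.re → ∀ g u : Matrix (Fin 2 ⊕ Fin 2) (Fin 2 ⊕ Fin 2) ℂ,
      gᴴ * Matrix.J (Fin 2) ℂ * g = Matrix.J (Fin 2) ℂ → uᴴ * Matrix.J (Fin 2) ℂ * u = Matrix.J (Fin 2) ℂ →
        moeb u (I • (1 : Matrix (Fin 2) (Fin 2) ℂ)) = I • 1 →
          F s (g * u) = (u.toBlocks₁₁ + I • u.toBlocks₁₂).det ^ m₁ * (u.toBlocks₁₁ - I • u.toBlocks₁₂).det ^ m₂ * F s g)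
    (hF1 : ∀ s : ℂ, 1 / 2 < s.re → F s 1 = c)
    {Fn : ℂ → ℂ} (hFn : DifferentiableOn ℂ Fn {s : ℂ | 0 < s.re})
    (hagree : ∀ s : ℂ, 1 / 2 < s.re → Fn s = archIntertwiningNormalized s (F s) h) :
    Fn (1 / 2) = 0 :=
  half_eq_zero_of_stabType m₁ m₂ (odd_of_eq_three_or_eq_neg_three hdef) (natAbs_ne_one_of_eq_three_or_eq_neg_three hdef)
    hh hP hK hF1 hFn hagree

/-- **(A∞-R) TWIN FOR THE INDEFINITE ANCHORS** (`|m₁ − m₂| = 1`, signatures `(2,1)` ∕ `(1,2)`; `Stab`-letters): the continuation takes the value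
`c · det(h)^{m₁} · f⁰_{−½,m₁−m₂}(h)` at `s = ½` (the det-twisted form of ★ `half_eq_of_natAbs_eq_one`). [KudlaRallis1994 (citation only)] -/
theorem half_eq_of_stabType_of_natAbs_eq_one (m₁ m₂ : ℤ) (h1 : (m₁ - m₂).natAbs = 1) {c : ℂ}
    {h : Matrix (Fin 2 ⊕ Fin 2) (Fin 2 ⊕ Fin 2) ℂ} (hh : hᴴ * Matrix.J (Fin 2) ℂ * h = Matrix.J (Fin 2) ℂ)
    {F : ℂ → Matrix (Fin 2 ⊕ Fin 2) (Fin 2 ⊕ Fin 2) ℂ → ℂ}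
    (hP : ∀ s : ℂ, 1 / 2 < s.re → IsArchSiegelSection (fun z : ℂ => (conj z / ((‖z‖ : ℝ) : ℂ)) ^ (-(m₁ + m₂))) s (F s))
    (hK : ∀ s : ℂ, 1 / 2 < s.re → ∀ g u : Matrix (Fin 2 ⊕ Fin 2) (Fin 2 ⊕ Fin 2) ℂ,
      gᴴ * Matrix.J (Fin 2) ℂ * g = Matrix.J (Fin 2) ℂ → uᴴ * Matrix.J (Fin 2) ℂ * u = Matrix.J (Fin 2) ℂ →
        moeb u (I • (1 : Matrix (Fin 2) (Fin 2) ℂ)) = I • 1 →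
          F s (g * u) = (u.toBlocks₁₁ + I • u.toBlocks₁₂).det ^ m₁ * (u.toBlocks₁₁ - I • u.toBlocks₁₂).det ^ m₂ * F s g)
    (hF1 : ∀ s : ℂ, 1 / 2 < s.re → F s 1 = c)
    {Fn : ℂ → ℂ} (hFn : DifferentiableOn ℂ Fn {s : ℂ | 0 < s.re})
    (hagree : ∀ s : ℂ, 1 / 2 < s.re → Fn s = archIntertwiningNormalized s (F s) h) :
    Fn (1 / 2) = c * h.det ^ m₁ * archScalarSection (m₁ - m₂) (-(1 / 2)) h := by
  rw [eq_contClosedForm_of_re_pos_of_stabType m₁ m₂ (odd_of_natAbs_eq_one h1) hh hP hK hF1 hFn hagree one_half_re_pos,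
    archNormalisedScalarCont_half_of_natAbs_eq_one h1, mul_one]

/-! ## §5  The same in the κ-chart letters of ★ S2-F part 2 (`f(g·κ(a,b)) = det(a)^{m₁}det(b)^{m₂}f(g)`; ★ `stabType_of_kappaType_UJ`) -/

/-- **(A∞-½) KERNEL FACE, κ-CHART LETTERS** (odd `m₁ − m₂`, `|m₁ − m₂| ≠ 1`): `Fn (½) = 0` (§4 via ★ `stabType_of_kappaType_UJ`).
[Shimura1982, (1.31)] -/
theorem half_eq_zero_of_kappaType (m₁ m₂ : ℤ) (hodd : Odd (m₁ - m₂)) (h1 : (m₁ - m₂).natAbs ≠ 1) {c : ℂ}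
    {h : Matrix (Fin 2 ⊕ Fin 2) (Fin 2 ⊕ Fin 2) ℂ} (hh : hᴴ * Matrix.J (Fin 2) ℂ * h = Matrix.J (Fin 2) ℂ)
    {F : ℂ → Matrix (Fin 2 ⊕ Fin 2) (Fin 2 ⊕ Fin 2) ℂ → ℂ}
    (hP : ∀ s : ℂ, 1 / 2 < s.re → IsArchSiegelSection (fun z : ℂ => (conj z / ((‖z‖ : ℝ) : ℂ)) ^ (-(m₁ + m₂))) s (F s))
    (hκ : ∀ s : ℂ, 1 / 2 < s.re → ∀ (g : Matrix (Fin 2 ⊕ Fin 2) (Fin 2 ⊕ Fin 2) ℂ) (a b : Matrix (Fin 2) (Fin 2) ℂ),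
      gᴴ * Matrix.J (Fin 2) ℂ * g = Matrix.J (Fin 2) ℂ → aᴴ * a = 1 → bᴴ * b = 1 →
        F s (g * ((fromBlocks 1 1 (I • 1) (-(I • 1)) : Matrix (Fin 2 ⊕ Fin 2) (Fin 2 ⊕ Fin 2) ℂ) * fromBlocks a 0 0 b *
          ((2 : ℂ)⁻¹ • fromBlocks 1 (-(I • 1)) 1 (I • 1)))) = a.det ^ m₁ * b.det ^ m₂ * F s g)
    (hF1 : ∀ s : ℂ, 1 / 2 < s.re → F s 1 = c)
    {Fn : ℂ → ℂ} (hFn : DifferentiableOn ℂ Fn {s : ℂ | 0 < s.re})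
    (hagree : ∀ s : ℂ, 1 / 2 < s.re → Fn s = archIntertwiningNormalized s (F s) h) :
    Fn (1 / 2) = 0 :=
  half_eq_zero_of_stabType m₁ m₂ hodd h1 hh hP (fun s hs => stabType_of_kappaType_UJ (hκ s hs)) hF1 hFn hagree

/-- **THE DEFINITE GAUSSIAN LINE IS KILLED AT `½`, BOTH SIGNS — κ-CHART LETTERS** (`m₁ − m₂ = ±3`; the ★ S2-F part 2 anchor
`eq_mul_det_zpow_mul_archScalarSection_of_kappaType` plugs in with zero glue). [Shimura1982, (1.31)] [KudlaSweet1997, §1 (citation only)] -/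
theorem half_eq_zero_of_kappaType_definite (m₁ m₂ : ℤ) (hdef : m₁ - m₂ = 3 ∨ m₁ - m₂ = -3) {c : ℂ}
    {h : Matrix (Fin 2 ⊕ Fin 2) (Fin 2 ⊕ Fin 2) ℂ} (hh : hᴴ * Matrix.J (Fin 2) ℂ * h = Matrix.J (Fin 2) ℂ)
    {F : ℂ → Matrix (Fin 2 ⊕ Fin 2) (Fin 2 ⊕ Fin 2) ℂ → ℂ}
    (hP : ∀ s : ℂ, 1 / 2 < s.re → IsArchSiegelSection (fun z : ℂ => (conj z / ((‖z‖ : ℝ) : ℂ)) ^ (-(m₁ + m₂))) s (F s))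
    (hκ : ∀ s : ℂ, 1 / 2 < s.re → ∀ (g : Matrix (Fin 2 ⊕ Fin 2) (Fin 2 ⊕ Fin 2) ℂ) (a b : Matrix (Fin 2) (Fin 2) ℂ),
      gᴴ * Matrix.J (Fin 2) ℂ * g = Matrix.J (Fin 2) ℂ → aᴴ * a = 1 → bᴴ * b = 1 →
        F s (g * ((fromBlocks 1 1 (I • 1) (-(I • 1)) : Matrix (Fin 2 ⊕ Fin 2) (Fin 2 ⊕ Fin 2) ℂ) * fromBlocks a 0 0 b *
          ((2 : ℂ)⁻¹ • fromBlocks 1 (-(I • 1)) 1 (I • 1)))) = a.det ^ m₁ * b.det ^ m₂ * F s g)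
    (hF1 : ∀ s : ℂ, 1 / 2 < s.re → F s 1 = c)
    {Fn : ℂ → ℂ} (hFn : DifferentiableOn ℂ Fn {s : ℂ | 0 < s.re})
    (hagree : ∀ s : ℂ, 1 / 2 < s.re → Fn s = archIntertwiningNormalized s (F s) h) :
    Fn (1 / 2) = 0 :=
  half_eq_zero_of_stabType_definite m₁ m₂ hdef hh hP (fun s hs => stabType_of_kappaType_UJ (hκ s hs)) hF1 hFn hagree

/-- **THE SAME IN THE SIGNATURE LETTERS** (`(p′, q′)` the signature of `V′` at `σ`, `p′ + q′ = 3`, DEFINITE: `p′ = 0 ∨ q′ = 0`, scalar index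
`m₁ − m₂ = p′ − q′`; κ-chart letters): `Fn (½) = 0`. [Shimura1982, (1.31)] [KudlaSweet1997, §1 (citation only)] -/
theorem half_eq_zero_of_kappaType_signature (m₁ m₂ : ℤ) {p q : ℕ} (hpq : p + q = 3) (hdef : p = 0 ∨ q = 0)
    (hk : m₁ - m₂ = (p : ℤ) - q) {c : ℂ}
    {h : Matrix (Fin 2 ⊕ Fin 2) (Fin 2 ⊕ Fin 2) ℂ} (hh : hᴴ * Matrix.J (Fin 2) ℂ * h = Matrix.J (Fin 2) ℂ)
    {F : ℂ → Matrix (Fin 2 ⊕ Fin 2) (Fin 2 ⊕ Fin 2) ℂ → ℂ}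
    (hP : ∀ s : ℂ, 1 / 2 < s.re → IsArchSiegelSection (fun z : ℂ => (conj z / ((‖z‖ : ℝ) : ℂ)) ^ (-(m₁ + m₂))) s (F s))
    (hκ : ∀ s : ℂ, 1 / 2 < s.re → ∀ (g : Matrix (Fin 2 ⊕ Fin 2) (Fin 2 ⊕ Fin 2) ℂ) (a b : Matrix (Fin 2) (Fin 2) ℂ),
      gᴴ * Matrix.J (Fin 2) ℂ * g = Matrix.J (Fin 2) ℂ → aᴴ * a = 1 → bᴴ * b = 1 →
        F s (g * ((fromBlocks 1 1 (I • 1) (-(I • 1)) : Matrix (Fin 2 ⊕ Fin 2) (Fin 2 ⊕ Fin 2) ℂ) * fromBlocks a 0 0 b *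
          ((2 : ℂ)⁻¹ • fromBlocks 1 (-(I • 1)) 1 (I • 1)))) = a.det ^ m₁ * b.det ^ m₂ * F s g)
    (hF1 : ∀ s : ℂ, 1 / 2 < s.re → F s 1 = c)
    {Fn : ℂ → ℂ} (hFn : DifferentiableOn ℂ Fn {s : ℂ | 0 < s.re})
    (hagree : ∀ s : ℂ, 1 / 2 < s.re → Fn s = archIntertwiningNormalized s (F s) h) :
    Fn (1 / 2) = 0 :=
  half_eq_zero_of_kappaType_definite m₁ m₂ (hk ▸ sub_eq_three_or_eq_neg_three_of_definite hpq hdef) hh hP hκ hF1 hFn hagree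

/-- **FUNCTION-LEVEL DEFINITE FACE** (κ-chart letters): for a continuation `Fn : ℂ → (M₄(ℂ) → ℂ)` of the normalised operator of the flat
definite-Gaussian family (`m₁ − m₂ = ±3`), holomorphic in `s` on `{0 < re s}` at every `h ∈ U(J)`, the value `Fn (½)` VANISHES ON `U(2,2)`.
[Shimura1982, (1.31)] -/
theorem half_apply_eq_zero_of_kappaType_definite (m₁ m₂ : ℤ) (hdef : m₁ - m₂ = 3 ∨ m₁ - m₂ = -3) {c : ℂ}
    {F : ℂ → Matrix (Fin 2 ⊕ Fin 2) (Fin 2 ⊕ Fin 2) ℂ → ℂ}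
    (hP : ∀ s : ℂ, 1 / 2 < s.re → IsArchSiegelSection (fun z : ℂ => (conj z / ((‖z‖ : ℝ) : ℂ)) ^ (-(m₁ + m₂))) s (F s))
    (hκ : ∀ s : ℂ, 1 / 2 < s.re → ∀ (g : Matrix (Fin 2 ⊕ Fin 2) (Fin 2 ⊕ Fin 2) ℂ) (a b : Matrix (Fin 2) (Fin 2) ℂ),
      gᴴ * Matrix.J (Fin 2) ℂ * g = Matrix.J (Fin 2) ℂ → aᴴ * a = 1 → bᴴ * b = 1 →
        F s (g * ((fromBlocks 1 1 (I • 1) (-(I • 1)) : Matrix (Fin 2 ⊕ Fin 2) (Fin 2 ⊕ Fin 2) ℂ) * fromBlocks a 0 0 b *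
          ((2 : ℂ)⁻¹ • fromBlocks 1 (-(I • 1)) 1 (I • 1)))) = a.det ^ m₁ * b.det ^ m₂ * F s g)
    (hF1 : ∀ s : ℂ, 1 / 2 < s.re → F s 1 = c)
    {Fn : ℂ → Matrix (Fin 2 ⊕ Fin 2) (Fin 2 ⊕ Fin 2) ℂ → ℂ}
    (hFn : ∀ h : Matrix (Fin 2 ⊕ Fin 2) (Fin 2 ⊕ Fin 2) ℂ, hᴴ * Matrix.J (Fin 2) ℂ * h = Matrix.J (Fin 2) ℂ →
      DifferentiableOn ℂ (fun s => Fn s h) {s : ℂ | 0 < s.re})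
    (hagree : ∀ s : ℂ, 1 / 2 < s.re → ∀ h : Matrix (Fin 2 ⊕ Fin 2) (Fin 2 ⊕ Fin 2) ℂ,
      hᴴ * Matrix.J (Fin 2) ℂ * h = Matrix.J (Fin 2) ℂ → Fn s h = archIntertwiningNormalized s (F s) h)
    {h : Matrix (Fin 2 ⊕ Fin 2) (Fin 2 ⊕ Fin 2) ℂ} (hh : hᴴ * Matrix.J (Fin 2) ℂ * h = Matrix.J (Fin 2) ℂ) :
    Fn (1 / 2) h = 0 :=
  half_eq_zero_of_kappaType_definite m₁ m₂ hdef hh hP hκ hF1 (hFn h hh) (fun s hs => hagree s hs h hh)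

/-- **(A∞-R) TWIN FOR THE INDEFINITE ANCHORS, κ-CHART LETTERS** (`|m₁ − m₂| = 1`, signatures `(2,1)` ∕ `(1,2)`):
`Fn (½) = c · det(h)^{m₁} · f⁰_{−½,m₁−m₂}(h)`. [KudlaRallis1994 (citation only)] -/
theorem half_eq_of_kappaType_of_natAbs_eq_one (m₁ m₂ : ℤ) (h1 : (m₁ - m₂).natAbs = 1) {c : ℂ}
    {h : Matrix (Fin 2 ⊕ Fin 2) (Fin 2 ⊕ Fin 2) ℂ} (hh : hᴴ * Matrix.J (Fin 2) ℂ * h = Matrix.J (Fin 2) ℂ)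
    {F : ℂ → Matrix (Fin 2 ⊕ Fin 2) (Fin 2 ⊕ Fin 2) ℂ → ℂ}
    (hP : ∀ s : ℂ, 1 / 2 < s.re → IsArchSiegelSection (fun z : ℂ => (conj z / ((‖z‖ : ℝ) : ℂ)) ^ (-(m₁ + m₂))) s (F s))
    (hκ : ∀ s : ℂ, 1 / 2 < s.re → ∀ (g : Matrix (Fin 2 ⊕ Fin 2) (Fin 2 ⊕ Fin 2) ℂ) (a b : Matrix (Fin 2) (Fin 2) ℂ),
      gᴴ * Matrix.J (Fin 2) ℂ * g = Matrix.J (Fin 2) ℂ → aᴴ * a = 1 → bᴴ * b = 1 →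
        F s (g * ((fromBlocks 1 1 (I • 1) (-(I • 1)) : Matrix (Fin 2 ⊕ Fin 2) (Fin 2 ⊕ Fin 2) ℂ) * fromBlocks a 0 0 b *
          ((2 : ℂ)⁻¹ • fromBlocks 1 (-(I • 1)) 1 (I • 1)))) = a.det ^ m₁ * b.det ^ m₂ * F s g)
    (hF1 : ∀ s : ℂ, 1 / 2 < s.re → F s 1 = c)
    {Fn : ℂ → ℂ} (hFn : DifferentiableOn ℂ Fn {s : ℂ | 0 < s.re})
    (hagree : ∀ s : ℂ, 1 / 2 < s.re → Fn s = archIntertwiningNormalized s (F s) h) :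
    Fn (1 / 2) = c * h.det ^ m₁ * archScalarSection (m₁ - m₂) (-(1 / 2)) h :=
  half_eq_of_stabType_of_natAbs_eq_one m₁ m₂ h1 hh hP (fun s hs => stabType_of_kappaType_UJ (hκ s hs)) hF1 hFn hagree

end Summit.HodgeConjecture.HodgeConjecture.Cruxes.HLiu418.K2LiuArchDefiniteScalarVanishing

end
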